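import Mathlib
import HarnessLib
import Summits.RiemannHypothesis.Statement
import Literature.NumberTheory.LFunctions.RHWave0

/-!
Route: InterimWave0

Carry-over of the interim blast's sorried statements ABOUT RiemannHypothesis from the interim Wave-0
family file (Statements/RH/Wave0.lean; harness21 @ d8f2665). Thesis (to be sharpened by the route
planner, D-0014e): the equivalences/implications these 8 statements assert (speiser_iff,
riemannHypothesis_iff_chebyshevPsi_isBigO, riemannHypothesis_iff_chebyshevTheta_isBigO,
riemannHypothesis_iff_mertensFunction_isBigO, riemannHypothesis_iff_liouvilleSum_isBigO, robin_iff…)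
hold and, combined, bear on RiemannHypothesis. They enter as UNSTAMPED statement items: grounder
first (most are cited results -> named facts in Literature), then refuter, then provers.

UNDER FLOOR: fewer than 2 cruxes remain after retriage (legacy route; D-0019).

Rationale: M5 migration (docs/m5/PLAN.md 2c‴ as amended by D-0014b): no workspace, no THESIS.md; the interim
decl text is in run/m5/workspaces/ for the operator and quoted in each item's --informal.

Novelty: none claimed (retriage 2026-08-14; expected grade `known`). Operator carry-over of seven published
RH-equivalences, all theorems in print and in Broughan, Equivalents of the Riemann Hypothesis, vol.
1 (Robin1984 Thm. 1, Lagarias2002 Thm. 1.1; doi:10.1017/9781108178228 ) and vol. 2 (Speiser1934 via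
LevinsonMontgomery1974 Thm. 1, Koch1901 via MontgomeryVaughan2007 Thm. 13.1 and sec. 15.1,
Littlewood1912 = Titchmarsh1986 Thm. 14.25 (C), BaezDuarte2003 Thm. 1.1; doi:10.1017/9781108178266
). Formal-side prior art: Mathlib's zeta and L-function library (arXiv:2503.00959) states
RiemannHypothesis, proves no equivalence. The only delta, formalisation, is mostly spent in-tree:
five of seven statements are kernel-checked in Literature (Literature.RH.speiser_iff_holds,
riemannHypothesis_iff_chebyshevPsi_isBigO_holds, ..Theta..,
riemannHypothesis_iff_mertensFunction_isBigO_holds, baezDuarte_iff_holds; standard axioms, lean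
check 2026-08-14); Robin, Lagarias are reduced to the named facts Nicolas2012 Prop. 2.1,
Schoenfeld1976 sec. 6, Briggs2006 (Literature.RH.robin_iff_of_three_facts, lagarias_iff_of_three_facts). No
item implies Summit.RiemannHypothesis; no Assembly: a holding pen, not a line of attack (cf.
routes Robin, NymanBeurling). Searched (lit search, lit search --hybrid, lit read): Broughan's
volumes; Speiser and Levinson-Montgomery (Titchmarsh1986 sec. 10.28 p. 209); Titchmarsh1986 p. 272;
MontgomeryVaughan2007 p. 322; formalisations of RH equivalents (none beyond arXiv:2503.00959 found).  [refs: 10.1017/9781108178228, 10.1017/9781108178266, 2503.00959, doi:10.1017/9781108178228, doi:10.1017/9781108178266, Robin1984, Lagarias2002, Speiser1934, LevinsonMontgomery1974, Koch1901, MontgomeryVaughan2007, Littlewood1912, Titchmarsh1986, BaezDuarte2003, Nicolas2012, Schoenfeld1976, Briggs2006]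

Barriers (technique_class: RH-equivalents chebyshev-psi-error Baez-Duarte-criterion): No mechanism, only equivalences: no catalogued barrier (20 read) blocks the items AS STATEMENTS;
four govern any USE of one as the road to RH.
- Literature.Barriers.RiemannHypothesis.LittlewoodOscillation (psi, theta items): blocks only
strengthenings of von Koch's bound (O(x^(1/2)), one-signed error) via the Landau-Mellin converse
[MontgomeryVaughan2007, Thm. 15.11]; the items state the surviving O(x^(1/2) log^2 x) form, proved
in-tree. Not hit.
- Literature.Barriers.RiemannHypothesis.MertensDisproof (M(x) item): kills eps-free Mertens bounds
[OdlyzkoTeRiele1985]; the item is Littlewood's O(x^(1/2+eps)), recorded there as equivalent to RH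
[Titchmarsh1986, Thm. 14.25 (C)], proved in-tree. Not hit.
- Literature.Barriers.RiemannHypothesis.NymanBeurlingObstructions (BaezDuarteIff): blocks the
natural Moebius approximation and fixed-coefficient series [BaezDuarte2000, Props. 4.4, 4.7]; the
equivalence is its recorded evasion [BaezDuarte2003, Thm. 1.1], proved in-tree; binds route
NymanBeurling, not this one.
- Literature.Barriers.RiemannHypothesis.MollifierLimitations (SpeiserIff): bounded mollifiers cannot
give 100 per cent of zeros on the line [BettinGonek2017, Thm. 1]; constrains Speiser's criterion as
a route (mollified moments), not the equivalence, proved in-tree.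
None concerns the Robin, Lagarias criteria. Summary: it evades nothing because it attempts nothing;
its only bet, faithful formalisation, is confirmed for five of seven by kernel-checked proofs.

sub-problem: RiemannHypothesis · status: open · opened operator:999:2871242 2026-08-13T05:39:11Z · rev 1 · ledger route-RiemannHypothesis-InterimWave0
GENERATED by the gate from the ledger (D-0016/17). Provers cite these decls: `theorem foo : Summit.RiemannHypothesis.RiemannHypothesis.Theses.InterimWave0.<Decl> := …` in Summits/RiemannHypothesis/RiemannHypothesis/Theorems/<Name>.lean.
-/

namespace Summit.RiemannHypothesis.RiemannHypothesis.Theses.InterimWave0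

open scoped BigOperators Topology Manifold Classical MeasureTheory ProbabilityTheory Matrix InnerProductSpace ComplexConjugate ContinuousMap
open Filter Set Function TopologicalSpace MeasureTheory

open Summit Literature.NumberTheory.LFunctions

/-- item stmt-RiemannHypothesis-0026 · support · rank 2 · open · by operator
sources: Speiser1934, LevinsonMontgomery1974, Thm. 1 and Corollary, Titchmarsh1986, sec. 10.28 (p. 209): Speiser's equivalence and (10.28.2), lean decl: Literature.RH.speiser_iff_holds (Literature/NumberTheory/LFunctions/RHClassicalEquivalentsSpeiserProofs.lean)
**rh.S18** (Speiser 1934, *Math. Ann.* 110; quantified by Levinson–Montgomery, *Acta Math.* 133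
(1974)). RH holds iff `ζ'` has no zeros in the open half-strip `0 < Re s < 1/2`. [cite: Speiser1934,
Math. Ann. 110]  [interim: Statements/RH/Wave0.lean:179 `speiser_iff`] -/
def SpeiserIff : Prop :=
  RiemannHypothesis ↔ ∀ s : ℂ, 0 < s.re → s.re < 1 / 2 → deriv riemannZeta s ≠ 0

/-- item stmt-RiemannHypothesis-0027 · support · rank 3 · open · by operator
sources: Koch1901, MontgomeryVaughan2007, Thm. 13.1 (p. 322) and sec. 15.1, lean decl: Literature.RH.riemannHypothesis_iff_chebyshevPsi_isBigO_holds (Literature/NumberTheory/LFunctions/RHClassicalEquivalentsVonKochProofs.lean)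
**rh.S19** (von Koch 1901, *Acta Math.* 24; explicit form Schoenfeld 1976). RH iff `ψ(x) = x +
O(x^{1/2} log² x)`. [cite: Koch1901, Acta Math. 24]  [interim: Statements/RH/Wave0.lean:195
`riemannHypothesis_iff_chebyshevPsi_isBigO`] -/
def RiemannHypothesisIffChebyshevPsiIsBigO : Prop :=
  RiemannHypothesis ↔ (fun x ↦ Chebyshev.psi x - x) =O[atTop] fun x ↦ x ^ (1 / 2 : ℝ) * Real.log x ^ 2

/-- item stmt-RiemannHypothesis-0028 · support · rank 4 · open · by operator
sources: Koch1901, MontgomeryVaughan2007, Thm. 13.1 eq. (13.3) and sec. 15.1, lean decl: Literature.RH.riemannHypothesis_iff_chebyshevTheta_isBigO_holds (Literature/NumberTheory/LFunctions/RHClassicalEquivalentsVonKochProofs.lean)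
**rh.S19** (von Koch 1901; Schoenfeld 1976). RH iff `θ(x) = x + O(x^{1/2} log² x)`. [cite: Koch1901]
[interim: Statements/RH/Wave0.lean:201 `riemannHypothesis_iff_chebyshevTheta_isBigO`] -/
def RiemannHypothesisIffChebyshevThetaIsBigO : Prop :=
  RiemannHypothesis ↔ (fun x ↦ Chebyshev.theta x - x) =O[atTop] fun x ↦ x ^ (1 / 2 : ℝ) * Real.log x ^ 2

/-- item stmt-RiemannHypothesis-0029 · support · rank 5 · open · by operator
sources: Littlewood1912, Titchmarsh1986, Thm. 14.25 (C) (p. 272), lean decl: Literature.RH.riemannHypothesis_iff_mertensFunction_isBigO_holds (Literature/NumberTheory/LFunctions/MertensBoundRH.lean)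
**rh.S21** (Littlewood 1912, *C. R.* 154; Titchmarsh §14.25). RH iff `M(x) = O(x^{1/2 + ε})` for
every `ε > 0`. [cite: Littlewood1912, C. R. 154]  [interim: Statements/RH/Wave0.lean:220
`riemannHypothesis_iff_mertensFunction_isBigO`] -/
def RiemannHypothesisIffMertensFunctionIsBigO : Prop :=
  RiemannHypothesis ↔ ∀ ε : ℝ, 0 < ε → (fun x ↦ (mertensFunction x : ℝ)) =O[atTop] fun x ↦ x ^ (1 / 2 + ε)

/-- item stmt-RiemannHypothesis-0030 · support · rank 7 · open · by operator
sources: Robin1984, Thm. 1 and sec. 4 Prop. 1, Nicolas2012, Prop. 2.1 (named fact Nicolas2012_logf_lower), Schoenfeld1976, sec. 6 (named fact Schoenfeld1976_theta), Briggs2006; Axler2017, sec. 2 (named fact Briggs2006_robinInequality_le), lean decl: Literature.RH.robin_iff_of_three_facts (Literature/NumberTheory/LFunctions/LagariasCriterionAssembly.lean)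
**rh.S24** (Robin, *J. Math. Pures Appl.* 63 (1984), Thm. 1). RH iff `σ(n) < e^γ n log log n` for
every `n > 5040`. [folklore]  [interim: Statements/RH/Wave0.lean:270 `robin_iff`] -/
def RobinIff : Prop :=
  RiemannHypothesis ↔ ∀ n : ℕ, 5040 < n → (ArithmeticFunction.sigma 1 n : ℝ) < Real.exp Real.eulerMascheroniConstant * n * Real.log (Real.log n)

/-- item stmt-RiemannHypothesis-0031 · support · rank 8 · open · by operator
sources: Lagarias2002, Thm. 1.1, Robin1984, Thm. 1, lean decl: Literature.RH.lagarias_iff_of_three_facts (Literature/NumberTheory/LFunctions/LagariasCriterionAssembly.lean)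
**rh.S25** (Lagarias, *Amer. Math. Monthly* 109 (2002), Thm. 1.1). RH iff `σ(n) ≤ H_n + exp(H_n)
log(H_n)` for every `n ≥ 1`, `H_n` the harmonic number. [folklore]  [interim:
Statements/RH/Wave0.lean:278 `lagarias_iff`] -/
def LagariasIff : Prop :=
  RiemannHypothesis ↔ ∀ n : ℕ, 1 ≤ n → (ArithmeticFunction.sigma 1 n : ℝ) ≤ (harmonic n : ℝ) + Real.exp (harmonic n) * Real.log (harmonic n)

/-- item stmt-RiemannHypothesis-0032 · support · rank 9 · open · by operator
sources: BaezDuarte2003, Thm. 1.1, BaezDuarte2000, Props. 4.4 and 4.7 (barrier NymanBeurlingObstructions), lean decl: Literature.RH.baezDuarte_iff_holds (Literature/NumberTheory/LFunctions/NymanBeurlingBaezDuarteProofs.lean)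
**rh.S27** (Nyman 1950, Beurling 1955, Báez-Duarte, *Rend. Lincei* 14 (2003), Thm. 1.1). RH iff the
indicator of `(0,1]` lies in the closed `L²(0,∞)`-span of the functions `x ↦ {1/(n x)}`, `n = 1, 2,
…`: for every `ε > 0` there are `N` and real coefficients `c₁, …, c_N` with `‖χ_(0,1] - ∑ₖ cₖ {1/(k
x)}‖_{L²(0,∞)} < ε`. [cite: Nyman1950, Beurling 1955 Báez-Duarte Rend. Lince]  [interim:
Statements/RH/Wave0.lean:288 `baezDuarte_iff`] -/
def BaezDuarteIff : Prop :=
  RiemannHypothesis ↔ ∀ ε : ℝ, 0 < ε → ∃ (N : ℕ) (c : Fin N → ℝ), eLpNorm (fun x : ℝ ↦ (Set.Ioc (0 : ℝ) 1).indicator 1 x - ∑ k : Fin N, c k * Int.fract (1 / (((k : ℕ) + 1 : ℝ) * x))) 2 (volume.restrict (Set.Ioi 0)) < ENNReal.ofReal ε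

end Summit.RiemannHypothesis.RiemannHypothesis.Theses.InterimWave0
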